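import Literature.Analysis.FluidPDE.GigaMiura2011ScaledAlignmentBlowupLimitHolds
import Literature.Analysis.FluidPDE.KNSSTypeIIHolds
import HarnessLib

/-!
# Giga–Miura 2011, Theorem 1.1 under (CA′) and (CA) — the named facts
# `gigaMiura2011_scaledAlignment_typeI` and `gigaMiura_continuousAlignment_typeI` discharged
# inside Literature, with the blow-up limit of the near-maximum rescaling (§2.1, pp. 5–6)

Analysis/FluidPDE proof file (everything proved; no definitions, no named facts), sibling of
`GigaMiura2011BlowupAnalysis.lean` / `ContinuousAlignmentTypeI.lean`, discharging their named facts
`Literature.Analysis.FluidPDE.gigaMiura2011_scaledAlignment_typeI` (Y. Giga, H. Miura, *On vorticity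
directions near singularities for the Navier–Stokes flows with infinite energy*, Comm. Math. Phys.
**303** (2011) 289–300 = Hokkaido Univ. Preprint **#956**, Theorem 1.1 (p. 3) under the relaxed
hypothesis (CA′) of Remark 1.4 (p. 4): "Let `u` be a type I mild solution of (NS) for `ℝ³ × (−1, 0)`
… [(CA′)] … Then `u` does not blow up at `t = 0`") and, by the tree's reduction
`gigaMiura_continuousAlignment_typeI_of_scaledAlignment` ((CA) is (CA′) with `o(1) = √(ν(T − t))`),
`Literature.Analysis.FluidPDE.gigaMiura_continuousAlignment_typeI` (Theorem 1.1 as printed). Both are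
already THEOREMS on the Summits side
(`Summit.NavierStokesRegularity.NavierStokesRegularity.Theorems.gigaMiura2011_scaledAlignment_typeI_holds`,
via the route machinery of `ScaledTopAlignment`), which Literature cannot import; this file gives the
Literature-internal discharge, following the printed §2.1 and reusing the Literature port of that
machinery (`GigaMiura2011ScaledAlignmentBlowupLimitHolds`).

## The printed proof (HUPS #956 §2.1, pp. 5–7) and how it is followed

"To prove the main theorem it suffices to prove that `lim_{t↑0} sup_{−1≤τ≤t} ‖u‖_∞(τ) < ∞` for
example by [GIM]. Assume the contrary … Then there is a sequence `{t_k}` with `t_k ↑ 0` such that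
`sup_{−1≤τ≤t_k} ‖u‖_∞(τ) = ‖u‖_∞(t_k) =: M_k ↑ ∞`. We take `x_k` such that `|u(x_k,t_k)| ≥ M_k − 1`.
We rescale … `u_k(x,t) = λ_k u(x_k + λ_k x, t_k + λ_k² t)` with `λ_k = 1/M_k`. Clearly
`|u_k(0,0)| ≥ 1 − 1/M_k` and `|u_k| ≤ 1` in `ℝ³ × (−M_k², 0]` … by (2.1) … a subsequence … converges
to bounded continuous functions `ū` and `ω̄` locally uniformly in `ℝ³ × (−∞, 0]`. Moreover, `ū` is a
mild solution … `|ū| ≤ 1`, `|ω̄| ≤ C` in `ℝ³ × (−∞, 0]` and `|ū(0,0)| = 1`" (pp. 5–6); "Under the type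
I condition … `‖u_k‖_∞(t) ≤ C₀(M_k²|t_k| + |t|)^{−1/2} ≤ C₀(−t)^{−1/2}`, which yields
`‖ū‖_∞(t) ≤ C₀(−t)^{−1/2}`" (p. 6); "These two propositions [2.1: Type I ⇒ `ω̄ ≢ 0`; 2.2: (CA′) ⇒
`ω̄ ≡ 0`] imply the main theorem" (p. 7). The steps:

1. *Boundedness suffices* (§A): the printed "[GIM]" continuation is, in the tree's Leray–Hopf frame,
   the proved `hasSmoothExtensionPast_of_bounded_holds` (Robinson–Rodrigo–Sadowski 2016 Thm 8.17).
2. *The near-maximum sequence* (§N, `exists_nearMax_sequence_of_unbounded`): from unboundedness on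
   `[0, T) × ℝ³` and boundedness on every closed sub-strip, times `t_k → T`, levels
   `M_k = sup_{[0,t_k]} |u| → ∞` and centres with `|u(t_k, x_k)| ≥ M_k − 1` (the supremum over `ℝ³`
   need not be attained, whence the printed `M_k − 1`; the printed "`sup_{τ≤t_k} = ‖u‖_∞(t_k)`" is
   replaced by choosing `t_k` as the time of a point within `1` of the running supremum, which gives
   the same two displayed properties).
3. *The blow-up limit* (§B, `gigaMiura2011_nearMax_blowupLimit`, the statement of pp. 5–6 that
   `GigaMiura2011BlowupAnalysis` lists under "What is NOT here"): the zooms are unit-viscosity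
   Oseen-mild fields bounded by `2` on windows `(−t_kM_k²/ν, 2B)` reaching a universal `B > 0` beyond
   the centre (Leray's rate at the near-maximum points `exists_lerayRate_point_of_unbounded` and
   Leray's (3.15) `exists_norm_le_two_mul_after` — the two inputs not spelled out in print that make
   the closed end `s = 0` of `(−∞, 0]` interior), so KNSS 2009 Lemma 6.1 (`KNSS2009_lemma61_oseenMild`,
   after the shift `s ↦ s + B`) extracts a subsequence converging pointwise, with its vorticities
   (`tendsto_curl_of_bounded_oseenMild`, KNSS Prop. 4.1 bounds (4.10) + Landau interpolation), to a
   bounded Oseen-mild field `ū` on `(−∞, B) × ℝ³`, smooth with all spatial derivatives bounded,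
   `|ū| ≤ 1` on `s ≤ 0` and `|ū(0,0)| = 1`.
4. *Proposition 2.2 as printed* (the tree theorem
   `gigaMiura2011_scaledAlignment_blowupLimit_curl_eq_zero_holds`, applied along the subsequence):
   under (CA′), `curl ū ≡ 0` on `s ≤ 0`.
5. *Type I passes to the limit* (§T, `sqrt_neg_mul_norm_le_of_typeI_nearMax`, the display of p. 6):
   `√(−s)|ū(s, y)| ≤ C/√ν` for `s < 0`.
6. *Proposition 2.1* (§P, `gigaMiura2011_nearMaxLimit_curl_ne_zero_of_typeI`: the printed
   statement for the limit `ū` itself, from the tree's class version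
   `gigaMiura2011_curl_not_identically_zero_of_typeI` — harmonic Liouville + KNSS Remark 6.1 +
   Type-I decay; non-triviality `ū(s, 0) ≠ 0` for `s < 0` near `0` by continuity from `|ū(0,0)| = 1`):
   `curl ū(s)(y) ≠ 0` for some `s < 0` — contradiction.

## Mathlib / tree search

Tree (all proved): `hasSmoothExtensionPast_of_bounded_holds` (`KNSSTypeIIHolds`),
`exists_lerayRate_point_of_unbounded`, `exists_norm_le_two_mul_after`, `zoom_isClassical_window`,
`zoom_oseen_window`, `curl_zoom`, `tendsto_curl_of_bounded_oseenMild`,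
`smooth_and_bounds_of_bounded_ancient_oseenMild`, `gigaMiura2011_scaledAlignment_blowupLimit_curl_eq_zero_holds`
(`GigaMiura2011ScaledAlignmentBlowupLimitHolds`), `KNSS2009_lemma61_oseenMild`
(`AncientMildCompactness`), `gigaMiura2011_curl_not_identically_zero_of_typeI`,
`gigaMiura_continuousAlignment_typeI_of_scaledAlignment` (`GigaMiura2011BlowupAnalysis`),
`oseenDuhamel_translate`, `smul_stPull_apply`, `contDiff_slice_of_contDiffOn`,
`continuousOn_timeLine_of_contDiffOn`. Mathlib: `Real.sSup_le`/`le_csSup`/`exists_lt_of_lt_csSup`,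
`Filter.Tendsto.eventually`, `tendsto_order`, `tendsto_inv_atTop_zero`.

## References

* Y. Giga, H. Miura, Comm. Math. Phys. 303 (2011) 289–300 = Hokkaido Univ. Preprint #956 (2010):
  Thm 1.1 (p. 3), Remark 1.4 (CA′) (p. 4), §2.1: the blow-up sequence and its limit (pp. 5–6),
  Prop. 2.1 (p. 6), Prop. 2.2 (p. 7). [GigaMiura2011]
* G. Koch, N. Nadirashvili, G. Seregin, V. Šverák, Acta Math. 203 (2009) 83–105 =
  arXiv:0709.3599: Prop. 4.1 with (4.10) (p. 8), Lemma 6.1 (p. 11). [KochNadirashviliSereginSverak2009]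
* J. Leray, Acta Math. 63 (1934): §19 (3.9) p. 224, §21 (3.14)–(3.16) p. 226. [Leray1934]
* J. C. Robinson, J. L. Rodrigo, W. Sadowski, *The three-dimensional Navier–Stokes equations*
  (CUP 2016), Thm 8.17. [RobinsonRodrigoSadowski2016]
-/

noncomputable section

open MeasureTheory Set Function Filter TopologicalSpace Metric
open _root_.Topology
open scoped RealInnerProductSpace NNReal ENNReal

namespace Literature.Analysis.FluidPDE

/-! ### §N. The near-maximum sequence of an unbounded solution (HUPS #956 p. 5) -/

section NearMax

variable {E : Type*} [NormedAddCommGroup E] {T : ℝ} {u : ℝ → E → E}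

/-- The supremum of `|u|` over a closed initial slab `[0, t] × E` on which `u` is bounded: an upper
bound, the least one, and attained up to any `ε > 0`. [folklore] -/
private theorem exists_isLUB_norm_slab {t : ℝ} (ht : 0 ≤ t)
    (hB : ∃ B : ℝ, ∀ τ ∈ Icc 0 t, ∀ x, ‖u τ x‖ ≤ B) :
    ∃ S : ℝ, (∀ τ ∈ Icc 0 t, ∀ x, ‖u τ x‖ ≤ S) ∧
      (∀ S' : ℝ, (∀ τ ∈ Icc 0 t, ∀ x, ‖u τ x‖ ≤ S') → S ≤ S') ∧
      ∀ ε > 0, ∃ τ ∈ Icc 0 t, ∃ x, S - ε < ‖u τ x‖ := by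
  obtain ⟨B, hB⟩ := hB
  set V : Set ℝ := (fun q : ℝ × E => ‖u q.1 q.2‖) '' (Icc 0 t ×ˢ univ) with hV
  have hne : V.Nonempty := ⟨‖u 0 0‖, ⟨(0, 0), ⟨⟨le_rfl, ht⟩, mem_univ _⟩, rfl⟩⟩
  have hbd : BddAbove V := by
    refine ⟨B, ?_⟩
    rintro _ ⟨q, hq, rfl⟩
    exact hB q.1 hq.1 q.2
  refine ⟨sSup V, fun τ hτ x => le_csSup hbd ⟨(τ, x), ⟨hτ, mem_univ _⟩, rfl⟩, fun S' hS' =>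
    csSup_le hne ?_, fun ε hε => ?_⟩
  · rintro _ ⟨q, hq, rfl⟩
    exact hS' q.1 hq.1 q.2
  · obtain ⟨_, ⟨q, hq, rfl⟩, hlt⟩ := exists_lt_of_lt_csSup hne (show sSup V - ε < sSup V by linarith)
    exact ⟨q.1, hq.1, q.2, hlt⟩

/-- **The near-maximum blow-up sequence** (Giga–Miura 2011, §2.1, HUPS #956 p. 5: "there is a
sequence `{t_k}` with `t_k ↑ 0` such that `sup_{−1≤τ≤t_k} ‖u‖_∞(τ) = ‖u‖_∞(t_k) =: M_k ↑ ∞` … We take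
`x_k` such that `|u(x_k, t_k)| ≥ M_k − 1`"), in the forward frame `[0, T)`: if `u` is bounded on
every closed sub-strip `[0, T'] × E`, `T' < T`, but unbounded on `[0, T) × E`, there are times
`t_k ∈ (0, T)`, `t_k → T`, levels `0 < M_k → ∞` with `|u| ≤ M_k` on `[0, t_k] × E`, and centres `x_k`
with `|u(t_k, x_k)| ≥ M_k − 1` (here `M_k` is the supremum of `|u|` over `[0, t_k] × E` and `t_k` the
time of a point within `1` of the running supremum). [cite: GigaMiura2011, §2.1 p. 5 (the blow-up sequence)] -/
theorem exists_nearMax_sequence_of_unbounded (hT : 0 < T)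
    (hslab : ∀ T' < T, ∃ B : ℝ, ∀ t ∈ Icc 0 T', ∀ x, ‖u t x‖ ≤ B)
    (hunb : ¬ ∃ B : ℝ, ∀ t ∈ Ico 0 T, ∀ x, ‖u t x‖ ≤ B) :
    ∃ (tk : ℕ → ℝ) (xk : ℕ → E) (M : ℕ → ℝ),
      (∀ k, tk k ∈ Ioo 0 T) ∧ Tendsto tk atTop (𝓝 T) ∧ (∀ k, 0 < M k) ∧ Tendsto M atTop atTop ∧
      (∀ k, ∀ τ ∈ Icc 0 (tk k), ∀ x, ‖u τ x‖ ≤ M k) ∧ ∀ k, M k - 1 ≤ ‖u (tk k) (xk k)‖ := by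
  push Not at hunb
  -- points of arbitrarily large velocity
  choose τ hτ z hz using fun n : ℕ => hunb (n : ℝ)
  -- the running supremum up to `τ n`, and a point within `1` of it
  have hS' : ∀ n, ∃ S : ℝ, (∀ σ ∈ Icc 0 (τ n), ∀ x, ‖u σ x‖ ≤ S) ∧
      ∃ t ∈ Icc 0 (τ n), ∃ x, S - 1 < ‖u t x‖ := fun n => by
    obtain ⟨S, hS, -, hε⟩ := exists_isLUB_norm_slab (u := u) (hτ n).1 (hslab (τ n) (hτ n).2)
    exact ⟨S, hS, hε 1 one_pos⟩
  choose S' hS'b t ht x hx using hS'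
  -- the supremum up to `t n`
  have hS : ∀ n, ∃ S : ℝ, (∀ σ ∈ Icc 0 (t n), ∀ y, ‖u σ y‖ ≤ S) ∧
      ∀ S₁ : ℝ, (∀ σ ∈ Icc 0 (t n), ∀ y, ‖u σ y‖ ≤ S₁) → S ≤ S₁ := fun n => by
    obtain ⟨S, hS, hle, -⟩ := exists_isLUB_norm_slab (u := u) (ht n).1
      (hslab (t n) ((ht n).2.trans_lt (hτ n).2))
    exact ⟨S, hS, hle⟩
  choose S hSb hSle using hS
  -- the bookkeeping inequalities
  have htT : ∀ n, t n < T := fun n => (ht n).2.trans_lt (hτ n).2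
  have hSS' : ∀ n, S n ≤ S' n := fun n =>
    hSle n (S' n) fun σ hσ y => hS'b n σ ⟨hσ.1, hσ.2.trans (ht n).2⟩ y
  have hnear : ∀ n, S n - 1 ≤ ‖u (t n) (x n)‖ := fun n => by linarith [hx n, hSS' n]
  have hbig : ∀ n : ℕ, (n : ℝ) - 1 < S n := fun n => by
    have h1 : (n : ℝ) < S' n := (hz n).trans_le (hS'b n (τ n) ⟨(hτ n).1, le_rfl⟩ (z n))
    have h2 : ‖u (t n) (x n)‖ ≤ S n := hSb n (t n) ⟨(ht n).1, le_rfl⟩ (x n)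
    linarith [hx n]
  have hSlim : Tendsto S atTop atTop := by
    refine tendsto_atTop_atTop.2 fun b => ⟨⌈b⌉₊ + 1, fun n hn => ?_⟩
    have h1 : b ≤ (⌈b⌉₊ : ℝ) := Nat.le_ceil b
    have h2 : ((⌈b⌉₊ + 1 : ℕ) : ℝ) ≤ n := by exact_mod_cast hn
    push_cast at h2
    linarith [hbig n]
  -- `t n → T`: below any `T' < T` the levels are bounded by the strip bound
  have htlim : Tendsto t atTop (𝓝 T) := by
    refine tendsto_order.2 ⟨fun T' hT' => ?_, fun T' hT' => Eventually.of_forall fun n =>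
      (htT n).trans hT'⟩
    rcases lt_or_ge T' 0 with hT'0 | hT'0
    · exact Eventually.of_forall fun n => hT'0.trans_le (ht n).1
    · obtain ⟨B, hB⟩ := hslab T' hT'
      filter_upwards [hSlim.eventually (eventually_gt_atTop B)] with n hn
      by_contra hle
      push Not at hle
      exact absurd (hSle n B fun σ hσ y => hB σ ⟨hσ.1, hσ.2.trans hle⟩ y) (not_le.2 hn)
  -- a tail on which `t n > 0` and `S n > 0`
  obtain ⟨n₀, hn₀⟩ : ∃ n₀ : ℕ, ∀ n, n₀ ≤ n → 0 < t n ∧ 0 < S n := by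
    have h1 : ∀ᶠ n in atTop, 0 < t n := htlim.eventually (eventually_gt_nhds hT)
    have h2 : ∀ᶠ n in atTop, 0 < S n := hSlim.eventually (eventually_gt_atTop 0)
    obtain ⟨n₀, hn₀⟩ := (h1.and h2).exists_forall_of_atTop
    exact ⟨n₀, hn₀⟩
  refine ⟨fun k => t (k + n₀), fun k => x (k + n₀), fun k => S (k + n₀), fun k =>
    ⟨(hn₀ _ (Nat.le_add_left n₀ k)).1, htT _⟩, htlim.comp (tendsto_add_atTop_nat n₀),
    fun k => (hn₀ _ (Nat.le_add_left n₀ k)).2, hSlim.comp (tendsto_add_atTop_nat n₀),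
    fun k σ hσ y => hSb _ σ hσ y, fun k => hnear _⟩

end NearMax

/-! ### §B. The blow-up limit of the near-maximum rescaling (HUPS #956 pp. 5–6) -/

section BlowupLimit

variable {ν T : ℝ} {u : ℝ → EuclideanSpace ℝ (Fin 3) → EuclideanSpace ℝ (Fin 3)}
  {p : ℝ → EuclideanSpace ℝ (Fin 3) → ℝ}

/-- Window bookkeeping for the zoom about `(t₀, x₀)`, `0 < t₀ < T` (as in
`GigaMiura2011ScaledAlignmentBlowupLimitHolds`, where it is private): the zoom time `s` is sent to
the physical time `t₀ + (λ²/ν) s ∈ (0, T)` exactly when `−t₀ν/λ² < s < (T − t₀)ν/λ²`. [folklore] -/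
private theorem zoom_time_mem'' (hν : 0 < ν) {t₀ lam : ℝ} (hlam : 0 < lam) {s : ℝ}
    (hs : s ∈ Ioo (-(t₀ * ν / lam ^ 2)) ((T - t₀) * ν / lam ^ 2)) :
    t₀ + lam ^ 2 / ν * s ∈ Ioo 0 T := by
  have hl2 : 0 < lam ^ 2 := by positivity
  have hc : 0 < lam ^ 2 / ν := div_pos hl2 hν
  constructor
  · have h2 : lam ^ 2 / ν * (-(t₀ * ν / lam ^ 2)) < lam ^ 2 / ν * s := mul_lt_mul_of_pos_left hs.1 hc
    have h3 : lam ^ 2 / ν * (-(t₀ * ν / lam ^ 2)) = -t₀ := by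
      field_simp
    linarith
  · have h2 : lam ^ 2 / ν * s < lam ^ 2 / ν * ((T - t₀) * ν / lam ^ 2) :=
      mul_lt_mul_of_pos_left hs.2 hc
    have h3 : lam ^ 2 / ν * ((T - t₀) * ν / lam ^ 2) = T - t₀ := by
      field_simp
    linarith

/-- **The blow-up limit of the near-maximum rescaling** (Giga–Miura 2011, §2.1, HUPS #956 pp. 5–6:
"`u_k(x,t) = λ_k u(x_k + λ_k x, t_k + λ_k² t)` with `λ_k = 1/M_k`. Clearly `|u_k(0,0)| ≥ 1 − 1/M_k` and
… `|u_k(x,t)| ≤ 1` in `ℝ³ × (−M_k², 0]` … Thus we can find a subsequence (still denoted `u_k`, `ω_k`)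
which converges to bounded continuous functions `ū` and `ω̄` locally uniformly in `ℝ³ × (−∞, 0]`.
Moreover, `ū` is a mild solution for (NS) … `|ū| ≤ 1`, `|ω̄| ≤ C` in `ℝ³ × (−∞, 0]` and
`|ū(0,0)| = 1`"). Tree frame (as in `gigaMiura2011_scaledAlignment_blowupLimit_curl_eq_zero`): a
classical solution `(u, p)` of viscosity `ν > 0` on `ℝ³ × [0, T)`, Leray–Hopf from `u 0`, bounded on
every closed sub-strip; a near-maximum sequence `t_k ∈ (0, T)`, `t_k → T`, `0 < M_k → ∞`, `|u| ≤ M_k`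
on `[0, t_k] × ℝ³`, `|u(t_k, x_k)| ≥ M_k − 1`; scales `λ_k = ν/M_k`, zooms
`u_k(s, y) = M_k⁻¹ u(t_k + λ_k²s/ν, x_k + λ_k y)` (unit viscosity). CONCLUSION: there are `B > 0`, a
subsequence `φ` and a field `ū` on `(−∞, B) × ℝ³` — jointly smooth with every spatial derivative
bounded, weakly divergence free, Oseen-mild (`ū(t) = e^{(t−s)Δ}ū(s) − B¹_s(ū, ū)(t)`, `s < t < B`),
`|ū| ≤ 2`, `|ū| ≤ 1` on `s ≤ 0`, `|ū(0, 0)| = 1` — to which the zooms `u_{φ(j)}` and their vorticities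
`(λ²/ν) ω(t + λ²s/ν, x + λy)` converge pointwise at every `s < B`. (The closed end `s = 0` is made
interior by Leray's rate at the near-maximum points and Leray's short-time bound after `t_k`, which give
`|u_k| ≤ 2` up to the universal zoom time `2B`; the extraction is KNSS 2009 Lemma 6.1 with Prop. 4.1.)
[cite: GigaMiura2011, §2.1 pp. 5–6 (the rescaled solutions u_k, (2.1), and their limit)] [cite: KochNadirashviliSereginSverak2009, Lemma 6.1 with Prop. 4.1 (arXiv:0709.3599 pp. 8, 11)] -/
theorem gigaMiura2011_nearMax_blowupLimit (hν : 0 < ν) (hT : 0 < T)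
    (hsol : IsClassicalNSSolutionOn (Ico 0 T) ν 0 u p) (hLH : IsLerayHopfOn T ν 0 (u 0) u)
    (hslab : ∀ T' < T, ∃ M : ℝ, ∀ t ∈ Icc 0 T', ∀ x, ‖u t x‖ ≤ M)
    {tk : ℕ → ℝ} {xk : ℕ → EuclideanSpace ℝ (Fin 3)} {M : ℕ → ℝ}
    (htk : ∀ k, tk k ∈ Ioo 0 T) (htkT : Tendsto tk atTop (𝓝 T))
    (hMpos : ∀ k, 0 < M k) (hMlim : Tendsto M atTop atTop)
    (hMbd : ∀ k, ∀ τ ∈ Icc 0 (tk k), ∀ x, ‖u τ x‖ ≤ M k)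
    (hnear : ∀ k, M k - 1 ≤ ‖u (tk k) (xk k)‖) :
    ∃ (B : ℝ) (φ : ℕ → ℕ) (U : ℝ → EuclideanSpace ℝ (Fin 3) → EuclideanSpace ℝ (Fin 3)),
      0 < B ∧ StrictMono φ ∧
      ContinuousOn (uncurry U) (Iio B ×ˢ univ) ∧
      ContDiffOn ℝ (⊤ : ℕ∞) (uncurry U) (Iio B ×ˢ univ) ∧
      (∀ k : ℕ, ∃ C : ℝ, ∀ s < B, ∀ y, ‖iteratedFDeriv ℝ k (U s) y‖ ≤ C) ∧
      (∀ s < B, IsWeaklyDivFree (U s)) ∧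
      (∀ s t : ℝ, s < t → t < B → ∀ y,
        U t y = UnboundedOperators.heatExtension (U s) (t - s) y - oseenDuhamel 1 s U U t y) ∧
      (∀ s < B, ∀ y, ‖U s y‖ ≤ 2) ∧
      (∀ s ≤ 0, ∀ y, ‖U s y‖ ≤ 1) ∧
      ‖U 0 0‖ = 1 ∧
      (∀ s < B, ∀ y, Tendsto (fun j => (M (φ j))⁻¹ •
          u (tk (φ j) + (ν / M (φ j)) ^ 2 * s / ν) (xk (φ j) + (ν / M (φ j)) • y)) atTop (𝓝 (U s y))) ∧
      (∀ s < B, ∀ y, Tendsto (fun j => ((ν / M (φ j)) ^ 2 / ν) •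
          curl (u (tk (φ j) + (ν / M (φ j)) ^ 2 * s / ν)) (xk (φ j) + (ν / M (φ j)) • y))
          atTop (𝓝 (curl (U s) y))) := by
  -- ### constants: Leray's rate `c`, Leray's window constant `C₁`
  obtain ⟨c, hc, hLer⟩ := exists_lerayRate_point_of_unbounded
  obtain ⟨C₁, hC₁, hapr⟩ := exists_norm_le_two_mul_after
  have hbdd : ∀ T₁ ∈ Ioo 0 T, ∃ B : ℝ, ∀ t ∈ Icc 0 T₁, ∀ x, ‖u t x‖ ≤ B := fun T₁ hT₁ =>
    hslab T₁ hT₁.2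
  -- `u` is unbounded on `[0, T) × ℝ³` (the near-maximum sequence)
  have hunb : ¬ ∃ B : ℝ, ∀ t ∈ Ico 0 T, ∀ x, ‖u t x‖ ≤ B := by
    rintro ⟨B, hB⟩
    have h1 : ∀ k, M k ≤ B + 1 := fun k => by
      have := (hnear k).trans (hB (tk k) (Ioo_subset_Ico_self (htk k)) (xk k))
      linarith
    have h2 : ∀ᶠ k in atTop, B + 2 ≤ M k := hMlim.eventually (eventually_ge_atTop (B + 2))
    obtain ⟨k, hk⟩ := h2.exists
    linarith [h1 k]
  -- Leray's rate at the near-maximum levels: `c²ν ≤ M_k² (T − t_k)`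
  have hrateM : ∀ k, c ^ 2 * ν ≤ M k ^ 2 * (T - tk k) := fun k => by
    obtain ⟨x, hx⟩ := hLer hν hT hsol hLH hbdd hunb (tk k) (Ioo_subset_Ico_self (htk k))
    have hMx : ‖u (tk k) x‖ ≤ M k := hMbd k (tk k) ⟨(htk k).1.le, le_rfl⟩ x
    have hsq : 0 < Real.sqrt (T - tk k) := Real.sqrt_pos.2 (sub_pos.2 (htk k).2)
    have h1 : c * Real.sqrt ν ≤ M k * Real.sqrt (T - tk k) := by
      rw [← div_le_iff₀ hsq]; exact hx.trans hMx
    have h2 : (c * Real.sqrt ν) ^ 2 ≤ (M k * Real.sqrt (T - tk k)) ^ 2 :=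
      pow_le_pow_left₀ (by positivity) h1 2
    rw [mul_pow, mul_pow, Real.sq_sqrt hν.le, Real.sq_sqrt (sub_pos.2 (htk k).2).le] at h2
    exact h2
  -- ### the scales `λ_k = ν/M_k`, the window ends `A_k = −t_kM_k²/ν`, `B'_k = (T−t_k)M_k²/ν ≥ c²`
  set lam : ℕ → ℝ := fun k => ν / M k with hlamdef
  have hlam : ∀ k, 0 < lam k := fun k => div_pos hν (hMpos k)
  have hM0 : ∀ k, M k ≠ 0 := fun k => (hMpos k).ne'
  have hν0 : ν ≠ 0 := hν.ne'
  have hlamM : ∀ k, lam k / ν * M k = 1 := fun k => by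
    simp only [hlamdef]; field_simp [hM0 k]
  have hlamν : ∀ k, lam k / ν = (M k)⁻¹ := fun k => by
    simp only [hlamdef]; field_simp
  have hlam2 : ∀ k, lam k ^ 2 / ν = ν / M k ^ 2 := fun k => by
    simp only [hlamdef]; field_simp
  have hlam0 : Tendsto lam atTop (𝓝 0) := tendsto_const_nhds.div_atTop hMlim
  set A : ℕ → ℝ := fun k => -(tk k * ν / lam k ^ 2) with hAdef
  set B' : ℕ → ℝ := fun k => (T - tk k) * ν / lam k ^ 2 with hB'def
  have hB'eq : ∀ k, B' k = (T - tk k) * M k ^ 2 / ν := fun k => by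
    simp only [hB'def, hlamdef]
    field_simp
  have hB'c : ∀ k, c ^ 2 ≤ B' k := fun k => by
    rw [hB'eq, le_div_iff₀ hν]
    linarith [hrateM k]
  -- the universal window length beyond the centre
  set B : ℝ := min (c ^ 2 / 4) (1 / (128 * C₁ ^ 2)) with hBdef
  have hBpos : 0 < B := lt_min (by positivity) (by positivity)
  have hBc : B ≤ c ^ 2 / 4 := min_le_left _ _
  have hBC : B ≤ 1 / (128 * C₁ ^ 2) := min_le_right _ _
  have hc2 : 0 < c ^ 2 := pow_pos hc 2
  have h2BB' : ∀ k, 2 * B < B' k := fun k => by linarith [hB'c k, hBc, hc2]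
  -- ### the zooms, their bound `1` on `(A_k, 0]` and `2` on `(A_k, 2B)`
  set w : ℕ → ℝ → EuclideanSpace ℝ (Fin 3) → EuclideanSpace ℝ (Fin 3) :=
    fun k => (lam k / ν) • stPull (lam k ^ 2 / ν) (lam k) (tk k) (xk k) u with hwdef
  -- the zoom in physical variables
  have hwphys : ∀ k s y, w k s y =
      (M k)⁻¹ • u (tk k + (ν / M k) ^ 2 * s / ν) (xk k + (ν / M k) • y) := by
    intro k s y
    have e2 : (ν / M k) ^ 2 / ν * s = (ν / M k) ^ 2 * s / ν := div_mul_eq_mul_div _ _ _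
    show (lam k / ν) • u (tk k + lam k ^ 2 / ν * s) (xk k + lam k • y) = _
    rw [hlamν k]
    simp only [hlamdef]
    rw [e2]
  have hwcl : ∀ k, IsClassicalNSSolutionOn (Ioo (A k) (B' k)) 1 0 (w k)
      ((lam k / ν) ^ 2 • stPull (lam k ^ 2 / ν) (lam k) (tk k) (xk k) p) := fun k =>
    zoom_isClassical_window (t₀ := tk k) (x₀ := xk k) hν hsol (hlam k)
  have hnorm_w : ∀ k s y (K : ℝ), (∀ x, ‖u (tk k + lam k ^ 2 / ν * s) x‖ ≤ K) →
      ‖w k s y‖ ≤ lam k / ν * K := by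
    intro k s y K hK
    show ‖(lam k / ν) • u (tk k + lam k ^ 2 / ν * s) (xk k + lam k • y)‖ ≤ _
    rw [norm_smul, Real.norm_of_nonneg (div_pos (hlam k) hν).le]
    exact mul_le_mul_of_nonneg_left (hK _) (div_pos (hlam k) hν).le
  have hw1 : ∀ k, ∀ s ∈ Ioc (A k) 0, ∀ y, ‖w k s y‖ ≤ 1 := by
    intro k s hs y
    have hsI : s ∈ Ioo (A k) (B' k) := ⟨hs.1, hs.2.trans_lt ((mul_pos two_pos hBpos).trans (h2BB' k))⟩
    have hτ := zoom_time_mem'' (T := T) (t₀ := tk k) hν (hlam k) hsI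
    -- physical time `≤ t_k`: the level `M_k` bounds `u`
    have hτle : tk k + lam k ^ 2 / ν * s ≤ tk k := by
      have : lam k ^ 2 / ν * s ≤ 0 :=
        mul_nonpos_of_nonneg_of_nonpos (div_pos (pow_pos (hlam k) 2) hν).le hs.2
      linarith
    have hK : ∀ x, ‖u (tk k + lam k ^ 2 / ν * s) x‖ ≤ M k := fun x =>
      hMbd k _ ⟨hτ.1.le, hτle⟩ x
    calc ‖w k s y‖ ≤ lam k / ν * M k := hnorm_w k s y (M k) hK
      _ = 1 := hlamM k
  have hwbd : ∀ k, ∀ s ∈ Ioo (A k) (2 * B), ∀ y, ‖w k s y‖ ≤ 2 := by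
    intro k s hs y
    have hsI : s ∈ Ioo (A k) (B' k) := ⟨hs.1, hs.2.trans (h2BB' k)⟩
    have hτ := zoom_time_mem'' (T := T) (t₀ := tk k) hν (hlam k) hsI
    rcases le_or_gt s 0 with hs0 | hs0
    · exact (hw1 k s ⟨hs.1, hs0⟩ y).trans (by norm_num)
    · -- physical time in `(t_k, T)`: Leray's (3.15) after `t_k` bounds `u` by `2M_k`
      have hu₀ : ∀ x, ‖u (tk k) x‖ ≤ M k := fun x => hMbd k _ ⟨(htk k).1.le, le_rfl⟩ x
      have hwin : 64 * C₁ ^ 2 * M k ^ 2 * (tk k + lam k ^ 2 / ν * s - tk k) < ν := by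
        rw [add_sub_cancel_left, hlam2 k]
        have hM2 : 0 < M k ^ 2 := pow_pos (hMpos k) 2
        have e : 64 * C₁ ^ 2 * M k ^ 2 * (ν / M k ^ 2 * s) = ν * (64 * C₁ ^ 2 * s) := by
          field_simp [hM0 k]
        rw [e]
        have hs1 : 64 * C₁ ^ 2 * s < 1 := by
          have h1 : s < 1 / (64 * C₁ ^ 2) := by
            have : 2 * B ≤ 2 * (1 / (128 * C₁ ^ 2)) := by linarith
            have e2 : 2 * (1 / (128 * C₁ ^ 2)) = 1 / (64 * C₁ ^ 2) := by
              field_simp; ring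
            linarith [hs.2]
          have h64 : 0 < 64 * C₁ ^ 2 := by positivity
          calc 64 * C₁ ^ 2 * s < 64 * C₁ ^ 2 * (1 / (64 * C₁ ^ 2)) := mul_lt_mul_of_pos_left h1 h64
            _ = 1 := by field_simp
        calc ν * (64 * C₁ ^ 2 * s) < ν * 1 := mul_lt_mul_of_pos_left hs1 hν
          _ = ν := mul_one ν
      have hτI : tk k + lam k ^ 2 / ν * s ∈ Ico (tk k) T :=
        ⟨by linarith [mul_pos (div_pos (pow_pos (hlam k) 2) hν) hs0], hτ.2⟩
      have hK : ∀ x, ‖u (tk k + lam k ^ 2 / ν * s) x‖ ≤ 2 * M k := fun x =>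
        hapr hν hT hsol hLH hbdd (Ioo_subset_Ico_self (htk k)) (hMpos k) hu₀ _ hτI hwin x
      calc ‖w k s y‖ ≤ lam k / ν * (2 * M k) := hnorm_w k s y (2 * M k) hK
        _ = 2 := by rw [mul_left_comm, hlamM k, mul_one]
  -- ### the shifted zooms `s ↦ w_k(s + B)` on `(A_k − B, 0)`
  set ws : ℕ → ℝ → EuclideanSpace ℝ (Fin 3) → EuclideanSpace ℝ (Fin 3) :=
    fun k s y => w k (s + B) y with hwsdef
  set As : ℕ → ℝ := fun k => A k - B with hAsdef
  have hshift : ∀ k, ∀ s ∈ Ioo (As k) 0, s + B ∈ Ioo (A k) (B' k) := fun k s hs =>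
    ⟨by simp only [hAsdef] at hs; linarith [hs.1], by linarith [hs.2, h2BB' k]⟩
  have hshift2 : ∀ k, ∀ s ∈ Ioo (As k) 0, s + B ∈ Ioo (A k) (2 * B) := fun k s hs =>
    ⟨by simp only [hAsdef] at hs; linarith [hs.1], by linarith [hs.2]⟩
  have hAs : Tendsto As atTop atBot := by
    have h1 : Tendsto (fun k => tk k * (M k ^ 2 / ν)) atTop atTop :=
      htkT.pos_mul_atTop hT (((tendsto_pow_atTop two_ne_zero).comp hMlim).atTop_div_const hν)
    have h2 : Tendsto (fun k => -(tk k * (M k ^ 2 / ν)) + -B) atTop atBot :=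
      tendsto_atBot_add_const_right _ _ (tendsto_neg_atTop_atBot.comp h1)
    refine h2.congr fun k => ?_
    simp only [hAsdef, hAdef, hlamdef]
    field_simp
    ring
  have hwsc : ∀ k, ContinuousOn (uncurry (ws k)) (Ioo (As k) 0 ×ˢ univ) := by
    intro k
    have hmap : Continuous fun q : ℝ × EuclideanSpace ℝ (Fin 3) => (q.1 + B, q.2) :=
      (continuous_fst.add continuous_const).prodMk continuous_snd
    have hinto : MapsTo (fun q : ℝ × EuclideanSpace ℝ (Fin 3) => (q.1 + B, q.2))
        (Ioo (As k) 0 ×ˢ univ) (Ioo (A k) (B' k) ×ˢ univ) := fun q hq =>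
      ⟨hshift k q.1 hq.1, mem_univ _⟩
    exact ((hwcl k).smooth_velocity.continuousOn.comp hmap.continuousOn hinto).congr
      fun q _ => rfl
  have hwsdiv : ∀ k, ∀ s ∈ Ioo (As k) 0, IsWeaklyDivFree (ws k s) := by
    intro k s hs
    have h := hwcl k
    exact VectorCalculus.IsDivFree.isWeaklyDivFree_holds (h.divFree (s + B) (hshift k s hs))
      ((h.contDiff_velocity (hshift k s hs)).of_le (by exact_mod_cast le_top))
  have hwsmild : ∀ k, ∀ s t : ℝ, As k < s → s < t → t < 0 → ∀ x,
      ws k t x = UnboundedOperators.heatExtension (ws k s) (t - s) x -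
        oseenDuhamel 1 s (ws k) (ws k) t x := by
    intro k s t hs hst ht x
    have hsI := hshift k s ⟨hs, hst.trans ht⟩
    have htI := hshift k t ⟨hs.trans hst, ht⟩
    have h := zoom_oseen_window (t₀ := tk k) (x₀ := xk k) hν hT hsol hLH hbdd (hlam k) hsI.1
      (show s + B < t + B by linarith) htI.2 x
    show w k (t + B) x = UnboundedOperators.heatExtension (w k (s + B)) (t - s) x -
      oseenDuhamel 1 s (fun τ => w k (τ + B)) (fun τ => w k (τ + B)) t x
    rw [oseenDuhamel_translate]
    rw [show t + B - (s + B) = t - s by ring] at h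
    exact h
  have hwsbd : ∀ k, ∀ s ∈ Ioo (As k) 0, ∀ y, ‖ws k s y‖ ≤ 2 := fun k s hs y =>
    hwbd k (s + B) (hshift2 k s hs) y
  -- ### KNSS Lemma 6.1: a locally uniformly convergent subsequence and its bounded ancient limit
  obtain ⟨φ, W, hφ, hWc, hWdiv, hWbd, hWmild, -, hpt, -⟩ :=
    KNSS2009_lemma61_oseenMild hAs hwsc hwsdiv hwsmild hwsbd
  have hφt : Tendsto φ atTop atTop := hφ.tendsto_atTop
  -- smoothness and uniform bounds of all spatial derivatives (KNSS §4)
  obtain ⟨hWsm, hWD⟩ := smooth_and_bounds_of_bounded_ancient_oseenMild hWc hWdiv hWmild hWbd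
  -- the vorticities converge along the subsequence, at every `s < 0`
  have hcurl : ∀ s < 0, ∀ y, Tendsto (fun j => curl (ws (φ j) s) y) atTop (𝓝 (curl (W s) y)) :=
    fun s hs y =>
    tendsto_curl_of_bounded_oseenMild (hAs.comp hφt) (fun j => hwsc (φ j)) (fun j => hwsdiv (φ j))
      (fun j => hwsmild (φ j)) (fun j => hwsbd (φ j)) hWc hWdiv hWmild hWbd
      (fun t ht x => (hpt t ht x)) hs y
  -- the vorticity of the shifted zoom in physical variables
  have hcurlw : ∀ k s y, curl (ws k s) y =
      (lam k ^ 2 / ν) • curl (u (tk k + lam k ^ 2 / ν * (s + B))) (xk k + lam k • y) :=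
    fun k s y => curl_zoom (s + B) y
  -- eventually the shifted window contains a given `s < 0`
  have hevAs : ∀ s : ℝ, ∀ᶠ j in atTop, As (φ j) < s := fun s =>
    (hAs.comp hφt).eventually (eventually_lt_atBot s)
  -- ### the limit in the original zoom clock: `ū(s) = W(s − B)` on `s < B`
  set U : ℝ → EuclideanSpace ℝ (Fin 3) → EuclideanSpace ℝ (Fin 3) := fun s y => W (s - B) y
    with hUdef
  -- pointwise convergence of the zooms to `ū` at every `s < B`
  have hconvU : ∀ s < B, ∀ y, Tendsto (fun j => w (φ j) s y) atTop (𝓝 (U s y)) := by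
    intro s hs y
    refine (hpt (s - B) (by linarith) y).congr fun j => ?_
    show w (φ j) (s - B + B) y = w (φ j) s y
    rw [sub_add_cancel]
  -- `ū` is `C^∞` on `(−∞, B) × ℝ³`
  have hUsm : ContDiffOn ℝ (⊤ : ℕ∞) (uncurry U) (Iio B ×ˢ univ) := by
    have hmap : ContDiff ℝ ((⊤ : ℕ∞) : WithTop ℕ∞)
        fun q : ℝ × EuclideanSpace ℝ (Fin 3) => (q.1 - B, q.2) :=
      (contDiff_fst.sub contDiff_const).prodMk contDiff_snd
    have hinto : MapsTo (fun q : ℝ × EuclideanSpace ℝ (Fin 3) => (q.1 - B, q.2)) (Iio B ×ˢ univ)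
        (Iio 0 ×ˢ univ) := by
      rintro ⟨s, y⟩ ⟨hs, -⟩
      refine ⟨?_, mem_univ _⟩
      show s - B < 0
      have hs' : s < B := hs
      linarith
    exact (hWsm.comp hmap.contDiffOn hinto).congr fun q _ => rfl
  refine ⟨B, φ, U, hBpos, hφ, hUsm.continuousOn, hUsm, fun k => ?_, fun s hs => hWdiv (s - B)
    (by linarith), ?_, fun s hs y => hWbd (s - B) (by linarith) y, ?_, ?_, ?_, ?_⟩
  · -- uniform bounds of the spatial derivatives
    obtain ⟨C, hC⟩ := hWD k
    exact ⟨C, fun s hs y => hC (s - B) (by linarith) y⟩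
  · -- the Oseen integral equation on `(−∞, B)`
    intro s t hst htB y
    have h := hWmild (s - B) (t - B) (by linarith) (by linarith) y
    have hfun : (fun τ y => W (τ - B) y) = fun τ => W (τ + -B) := by
      funext τ y
      rw [← sub_eq_add_neg]
    show W (t - B) y = UnboundedOperators.heatExtension (W (s - B)) (t - s) y -
      oseenDuhamel 1 s (fun τ y => W (τ - B) y) (fun τ y => W (τ - B) y) t y
    rw [hfun, oseenDuhamel_translate, ← sub_eq_add_neg, ← sub_eq_add_neg]
    rw [show t - B - (s - B) = t - s by ring] at h
    exact h
  · -- `|ū| ≤ 1` on `s ≤ 0`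
    intro s hs y
    have hev : ∀ᶠ j in atTop, ‖w (φ j) s y‖ ≤ 1 := by
      filter_upwards [hevAs (s - B)] with j hj
      exact hw1 (φ j) s ⟨by simp only [hAsdef] at hj; linarith, hs⟩ y
    exact le_of_tendsto ((hconvU s (by linarith) y).norm) hev
  · -- `|ū(0, 0)| = 1`
    refine le_antisymm ?_ ?_
    · have hev : ∀ᶠ j in atTop, ‖w (φ j) 0 0‖ ≤ 1 := by
        filter_upwards [hevAs (0 - B)] with j hj
        exact hw1 (φ j) 0 ⟨by simp only [hAsdef] at hj; linarith, le_rfl⟩ 0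
      exact le_of_tendsto ((hconvU 0 hBpos 0).norm) hev
    · -- `|u_k(0,0)| = M_k⁻¹ |u(t_k, x_k)| ≥ 1 − 1/M_k → 1`
      have hlow : ∀ j, 1 - (M (φ j))⁻¹ ≤ ‖w (φ j) 0 0‖ := fun j => by
        set k := φ j with hk
        have e : w k 0 0 = (M k)⁻¹ • u (tk k) (xk k) := by
          rw [hwphys]
          simp only [mul_zero, zero_div, add_zero, smul_zero]
        rw [e, norm_smul, Real.norm_of_nonneg (inv_pos.2 (hMpos k)).le]
        have h1 : (M k)⁻¹ * (M k - 1) ≤ (M k)⁻¹ * ‖u (tk k) (xk k)‖ :=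
          mul_le_mul_of_nonneg_left (hnear k) (inv_pos.2 (hMpos k)).le
        have e2 : (M k)⁻¹ * (M k - 1) = 1 - (M k)⁻¹ := by field_simp [hM0 k]
        linarith
      have hlim1 : Tendsto (fun j => 1 - (M (φ j))⁻¹) atTop (𝓝 1) := by
        have h := (tendsto_inv_atTop_zero.comp (hMlim.comp hφt)).const_sub 1
        rw [sub_zero] at h
        exact h
      exact le_of_tendsto_of_tendsto' hlim1 ((hconvU 0 hBpos 0).norm) hlow
  · -- convergence of the zooms (physical variables)
    intro s hs y
    refine (hconvU s hs y).congr fun j => ?_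
    rw [hwphys]
  · -- convergence of the vorticities (physical variables)
    intro s hs y
    have hsB : s - B < 0 := by linarith
    refine (hcurl (s - B) hsB y).congr fun j => ?_
    have e1 : (ν / M (φ j)) ^ 2 / ν = ν / M (φ j) ^ 2 := by field_simp [hM0 (φ j)]
    have e2 : (ν / M (φ j)) ^ 2 * s / ν = ν / M (φ j) ^ 2 * s := by field_simp [hM0 (φ j)]
    rw [e1, e2, hcurlw (φ j) (s - B) y, sub_add_cancel, hlam2 (φ j)]

end BlowupLimit

/-! ### §T. The Type-I bound passes to the blow-up limit (HUPS #956 p. 6) -/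

section TypeI

variable {ν T : ℝ} {u : ℝ → EuclideanSpace ℝ (Fin 3) → EuclideanSpace ℝ (Fin 3)}

/-- **Type I is inherited by the near-maximum blow-up limit** (Giga–Miura 2011, proof of Prop. 2.1,
HUPS #956 p. 6: "From the type I assumption it follows that
`‖u_k‖_∞(t) ≤ C₀M_k⁻¹(|t_k| + M_k⁻²|t|)^{−1/2} = C₀(M_k²|t_k| + |t|)^{−1/2} ≤ C₀(−t)^{−1/2}`, which
yields `‖ū‖_∞(t) ≤ C₀(−t)^{−1/2}`"). Forward frame with viscosity `ν` and blow-up time `T`: if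
`|u(t, x)| ≤ C/√(T − t)` for `t < T` near `T`, `t_k < T`, `t_k → T`, `0 < M_k → ∞`, and the zoomed
velocities `M_k⁻¹ u(t_k + νs/M_k², x_k + (ν/M_k)y)` at a zoom time `s < 0` converge to `V`, then
`√(−s)|V| ≤ C/√ν` (the physical time `t_k − ν(−s)/M_k²` has `T − t ≥ ν(−s)/M_k²`).
[cite: GigaMiura2011, Prop. 2.1, proof (§2.1; HUPS preprint #956 p. 6)] -/
theorem sqrt_neg_mul_norm_le_of_typeI_nearMax (hν : 0 < ν) {C : ℝ}
    (hC : ∀ᶠ t in 𝓝[<] T, ∀ x, ‖u t x‖ ≤ C / Real.sqrt (T - t))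
    {tk : ℕ → ℝ} {xk : ℕ → EuclideanSpace ℝ (Fin 3)} {M : ℕ → ℝ}
    (htk : ∀ k, tk k < T) (htkT : Tendsto tk atTop (𝓝 T)) (hMpos : ∀ k, 0 < M k)
    (hMlim : Tendsto M atTop atTop) {s : ℝ} (hs : s < 0) {y V : EuclideanSpace ℝ (Fin 3)}
    (hconv : Tendsto (fun k => (M k)⁻¹ • u (tk k + (ν / M k) ^ 2 * s / ν) (xk k + (ν / M k) • y))
      atTop (𝓝 V)) :
    Real.sqrt (-s) * ‖V‖ ≤ C / Real.sqrt ν := by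
  have hν0 : ν ≠ 0 := hν.ne'
  have hM0 : ∀ k, M k ≠ 0 := fun k => (hMpos k).ne'
  -- the physical times `τ_k = t_k + ν s/M_k² → T` from the left
  set τ : ℕ → ℝ := fun k => tk k + (ν / M k) ^ 2 * s / ν with hτdef
  have hτeq : ∀ k, τ k = tk k - ν * (-s) / M k ^ 2 := fun k => by
    simp only [hτdef]
    field_simp
    ring
  have hgap : ∀ k, ν * (-s) / M k ^ 2 ≤ T - τ k := fun k => by
    rw [hτeq k]
    linarith [htk k]
  have hgap_pos : ∀ k, 0 < ν * (-s) / M k ^ 2 := fun k =>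
    div_pos (mul_pos hν (neg_pos.2 hs)) (pow_pos (hMpos k) 2)
  have hτT : ∀ k, τ k < T := fun k => by linarith [hgap k, hgap_pos k]
  have hτlim : Tendsto τ atTop (𝓝 T) := by
    have h1 : Tendsto (fun k => ν * (-s) / M k ^ 2) atTop (𝓝 0) := by
      have h := (tendsto_const_nhds (x := ν * (-s))).div_atTop
        ((tendsto_pow_atTop two_ne_zero).comp hMlim)
      exact h
    have h2 := htkT.sub h1
    rw [sub_zero] at h2
    exact h2.congr fun k => (hτeq k).symm
  have hτW : Tendsto τ atTop (𝓝[<] T) :=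
    tendsto_nhdsWithin_iff.2 ⟨hτlim, Eventually.of_forall fun k => hτT k⟩
  have hev : ∀ᶠ k in atTop, ∀ x, ‖u (τ k) x‖ ≤ C / Real.sqrt (T - τ k) := hτW.eventually hC
  -- `C ≥ 0`
  have hC0 : 0 ≤ C := by
    obtain ⟨k, hk⟩ := hev.exists
    have h1 : 0 ≤ C / Real.sqrt (T - τ k) := (norm_nonneg _).trans (hk 0)
    have h2 : 0 < Real.sqrt (T - τ k) := Real.sqrt_pos.2 (sub_pos.2 (hτT k))
    have h3 := (le_div_iff₀ h2).1 h1
    simpa using h3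
  -- the zoomed velocities are eventually bounded by `C/(√ν √(−s))`
  have hsq : 0 < Real.sqrt ν * Real.sqrt (-s) :=
    mul_pos (Real.sqrt_pos.2 hν) (Real.sqrt_pos.2 (neg_pos.2 hs))
  have hbound : ∀ᶠ k in atTop,
      ‖(M k)⁻¹ • u (tk k + (ν / M k) ^ 2 * s / ν) (xk k + (ν / M k) • y)‖ ≤
        C / (Real.sqrt ν * Real.sqrt (-s)) := by
    filter_upwards [hev] with k hk
    have hx := hk (xk k + (ν / M k) • y)
    rw [norm_smul, Real.norm_of_nonneg (inv_pos.2 (hMpos k)).le]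
    -- `√(T − τ_k) ≥ √(ν(−s))/M_k`
    have hsqrt : Real.sqrt ν * Real.sqrt (-s) / M k ≤ Real.sqrt (T - τ k) := by
      have e : Real.sqrt ν * Real.sqrt (-s) / M k = Real.sqrt (ν * (-s) / M k ^ 2) := by
        rw [Real.sqrt_div' _ (pow_nonneg (hMpos k).le 2), Real.sqrt_sq (hMpos k).le,
          Real.sqrt_mul hν.le]
      rw [e]
      exact Real.sqrt_le_sqrt (hgap k)
    have hpos' : 0 < Real.sqrt ν * Real.sqrt (-s) / M k := div_pos hsq (hMpos k)
    have h1 : C / Real.sqrt (T - τ k) ≤ C / (Real.sqrt ν * Real.sqrt (-s) / M k) :=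
      div_le_div_of_nonneg_left hC0 hpos' hsqrt
    have h2 : (M k)⁻¹ * (C / (Real.sqrt ν * Real.sqrt (-s) / M k)) =
        C / (Real.sqrt ν * Real.sqrt (-s)) := by
      field_simp [hM0 k, hsq.ne']
    calc (M k)⁻¹ * ‖u (τ k) (xk k + (ν / M k) • y)‖
        ≤ (M k)⁻¹ * (C / Real.sqrt (T - τ k)) :=
          mul_le_mul_of_nonneg_left hx (inv_pos.2 (hMpos k)).le
      _ ≤ (M k)⁻¹ * (C / (Real.sqrt ν * Real.sqrt (-s) / M k)) :=
          mul_le_mul_of_nonneg_left h1 (inv_pos.2 (hMpos k)).le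
      _ = C / (Real.sqrt ν * Real.sqrt (-s)) := h2
  have hV : ‖V‖ ≤ C / (Real.sqrt ν * Real.sqrt (-s)) := le_of_tendsto hconv.norm hbound
  have hsqs : 0 < Real.sqrt (-s) := Real.sqrt_pos.2 (neg_pos.2 hs)
  calc Real.sqrt (-s) * ‖V‖ ≤ Real.sqrt (-s) * (C / (Real.sqrt ν * Real.sqrt (-s))) :=
        mul_le_mul_of_nonneg_left hV hsqs.le
    _ = C / Real.sqrt ν := by
        field_simp [hsqs.ne', (Real.sqrt_pos.2 hν).ne']

end TypeI

/-! ### §P. Proposition 2.1 for the blow-up limit itself (HUPS #956 p. 6) -/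

section PropositionTwoOne

variable {ν T : ℝ} {u : ℝ → EuclideanSpace ℝ (Fin 3) → EuclideanSpace ℝ (Fin 3)}

/-- **Giga–Miura 2011, Proposition 2.1 as printed, for the near-maximum blow-up limit**
(HUPS #956 p. 6 = CMP 303 §2.1: "Under the type I condition we will show that the backward global
solution `ω̄` is nontrivial. **Proposition 2.1.** Assume that `u` is a type I mild solution of (NS)
in `ℝ³ × (−1, 0)`. Then `ω̄ ≢ 0` in `ℝ³ × (−∞, 0]`", `ω̄` the vorticity of the blow-up limit `ū` of
the near-maximum rescaling of pp. 5–6; the tree's `gigaMiura2011_curl_not_identically_zero_of_typeI`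
is the same statement for the CLASS of such limits). Forward frame: `u` is Type I at `T`
(`IsTypeIBlowup u T`); `t_k < T`, `t_k → T`, `0 < M_k → ∞`; `ū` is a field on `(−∞, B) × ℝ³`,
`B > 0`, jointly smooth, bounded, weakly divergence free, Oseen-mild, with `ū(0, 0) ≠ 0`, to which
the zoomed velocities `M_k⁻¹ u(t_k + νs/M_k², x_k + (ν/M_k)y)` converge at every `s < 0` (all of this
is supplied by `gigaMiura2011_nearMax_blowupLimit` along its subsequence). Then `ū` has the Type-I
rate `√(−s)|ū(s, y)| ≤ C` on `s < 0` (`sqrt_neg_mul_norm_le_of_typeI_nearMax`) and `curl ū(s)(y) ≠ 0`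
for some `s < 0`, `y` (harmonic Liouville + KNSS Remark 6.1 + the Type-I decay, as printed:
`gigaMiura2011_curl_not_identically_zero_of_typeI`, non-triviality at some `s < 0` from `ū(0,0) ≠ 0`
by continuity). [cite: GigaMiura2011, Prop. 2.1 and its proof (§2.1; HUPS preprint #956 p. 6)] -/
theorem gigaMiura2011_nearMaxLimit_curl_ne_zero_of_typeI (hν : 0 < ν) (hI : IsTypeIBlowup u T)
    {tk : ℕ → ℝ} {xk : ℕ → EuclideanSpace ℝ (Fin 3)} {M : ℕ → ℝ}
    (htk : ∀ k, tk k < T) (htkT : Tendsto tk atTop (𝓝 T)) (hMpos : ∀ k, 0 < M k)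
    (hMlim : Tendsto M atTop atTop) {B : ℝ} (hB : 0 < B)
    {U : ℝ → EuclideanSpace ℝ (Fin 3) → EuclideanSpace ℝ (Fin 3)}
    (hUsm : ContDiffOn ℝ (⊤ : ℕ∞) (uncurry U) (Iio B ×ˢ univ))
    (hUbd : ∃ K : ℝ, ∀ s < B, ∀ y, ‖U s y‖ ≤ K)
    (hUdiv : ∀ s < B, IsWeaklyDivFree (U s))
    (hUmild : ∀ s t : ℝ, s < t → t < B → ∀ y,
      U t y = UnboundedOperators.heatExtension (U s) (t - s) y - oseenDuhamel 1 s U U t y)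
    (hU0 : U 0 0 ≠ 0)
    (hUconv : ∀ s < 0, ∀ y, Tendsto (fun k => (M k)⁻¹ •
      u (tk k + (ν / M k) ^ 2 * s / ν) (xk k + (ν / M k) • y)) atTop (𝓝 (U s y))) :
    (∃ C : ℝ, ∀ s < 0, ∀ y, Real.sqrt (-s) * ‖U s y‖ ≤ C) ∧ ∃ s < 0, ∃ y, curl (U s) y ≠ 0 := by
  -- Type I passes to the limit
  obtain ⟨C, hC⟩ := hI
  have hIU : ∀ s < 0, ∀ y, Real.sqrt (-s) * ‖U s y‖ ≤ C / Real.sqrt ν := fun s hs y =>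
    sqrt_neg_mul_norm_le_of_typeI_nearMax hν hC htk htkT hMpos hMlim hs (hUconv s hs y)
  refine ⟨⟨C / Real.sqrt ν, hIU⟩, ?_⟩
  -- non-triviality at some `s < 0`: `ū(0,0) ≠ 0` and continuity of the time line
  have hnt : ∃ s < 0, ∃ y, U s y ≠ 0 := by
    have hline : ContinuousOn (fun s => U s 0) (Iio B) := continuousOn_timeLine_of_contDiffOn hUsm 0
    have hat : ContinuousAt (fun s => U s 0) 0 := hline.continuousAt (Iio_mem_nhds hB)
    have hev : ∀ᶠ s in 𝓝 (0 : ℝ), U s 0 ≠ 0 := hat.eventually_ne hU0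
    obtain ⟨s, hs, hs0⟩ := ((hev.filter_mono nhdsWithin_le_nhds).and
      (self_mem_nhdsWithin : Iio (0 : ℝ) ∈ 𝓝[<] (0 : ℝ))).exists
    exact ⟨s, hs0, 0, hs⟩
  -- Proposition 2.1 for the class: a non-trivial Type-I ancient mild field has `curl ≢ 0`
  obtain ⟨K, hK⟩ := hUbd
  have h := gigaMiura2011_curl_not_identically_zero_of_typeI (C₀ := C / Real.sqrt ν) (v := U)
    (fun t ht => contDiff_infty.1
      (contDiff_slice_of_contDiffOn hUsm (show t ∈ Iio B from ht.trans hB)) 2)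
    ⟨K, fun t ht x => hK t (ht.trans hB) x⟩ (fun t ht => hUdiv t (ht.trans hB))
    (fun s t hst ht x => hUmild s t hst (ht.trans hB) x) hnt hIU
  push Not at h
  exact h

end PropositionTwoOne

/-! ### §A. Assembly: Theorem 1.1 under (CA′), and under (CA) -/

section Assembly

/-- **Giga–Miura 2011, Theorem 1.1 under (CA′), PROVED inside Literature** — discharge of the named
fact `gigaMiura2011_scaledAlignment_typeI` (HUPS #956 Thm 1.1 p. 3 with Remark 1.4 p. 4 = CMP 303 §1;
proof §2.1 pp. 5–9: "To prove the main theorem it suffices to prove that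
`lim_{t↑0} sup_{τ≤t} ‖u‖_∞(τ) < ∞` … These two propositions [2.1, 2.2] imply the main theorem").
Tree frame (module docstring of `ContinuousAlignmentTypeI`): a classical solution `(u, p)` of
viscosity `ν > 0` on `ℝ³ × [0, T)`, Leray–Hopf from `u 0`, bounded on every `[0, T'] × ℝ³` (`T' < T`),
Type I at `T` (`IsTypeIBlowup u T`), with (CA′) = `HasScaledContinuousAlignment ν T u`; conclusion
`HasSmoothExtensionPast ν 0 u T`. Proof as printed (module docstring): if `u` were unbounded on
`[0, T) × ℝ³`, the near-maximum rescaling (`exists_nearMax_sequence_of_unbounded`) has a blow-up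
limit `ū` (`gigaMiura2011_nearMax_blowupLimit`) with `|ū(0,0)| = 1`, whose vorticity vanishes on
`s ≤ 0` by Proposition 2.2 (`gigaMiura2011_scaledAlignment_blowupLimit_curl_eq_zero_holds`) and which
inherits the Type-I bound (`sqrt_neg_mul_norm_le_of_typeI_nearMax`) — contradicting Proposition 2.1
(`gigaMiura2011_curl_not_identically_zero_of_typeI`); so `u` is bounded and continues past `T`
(`hasSmoothExtensionPast_of_bounded_holds`, the printed "[GIM]"). [cite: GigaMiura2011, Thm 1.1 with Remark 1.4 (CA′) (§1, HUPS preprint #956 pp. 3–4; proof §2.1 pp. 5–9)] -/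
theorem gigaMiura2011_scaledAlignment_typeI_holds : gigaMiura2011_scaledAlignment_typeI := by
  intro ν T hν hT u p hsol hLH hslab hI hCA
  refine hasSmoothExtensionPast_of_bounded_holds hν hT hsol hLH ?_
  by_contra hunb
  -- the near-maximum sequence and its blow-up limit
  obtain ⟨tk, xk, M, htk, htkT, hMpos, hMlim, hMbd, hnear⟩ :=
    exists_nearMax_sequence_of_unbounded (u := u) hT hslab hunb
  obtain ⟨B, φ, U, hB, hφ, -, hUsm, -, hUdiv, hUmild, hU2, -, hU00, hUconv, hUcurl⟩ :=
    gigaMiura2011_nearMax_blowupLimit hν hT hsol hLH hslab htk htkT hMpos hMlim hMbd hnear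
  have hφt : Tendsto φ atTop atTop := hφ.tendsto_atTop
  -- Proposition 2.2 (as printed) along the subsequence: `curl ū ≡ 0` on `s ≤ 0`
  have hzero : ∀ s ≤ 0, ∀ y, curl (U s) y = 0 :=
    gigaMiura2011_scaledAlignment_blowupLimit_curl_eq_zero_holds hν hT hsol hLH hslab hCA
      (fun j => tk (φ j)) (fun j => xk (φ j)) (fun j => M (φ j)) (fun j => htk (φ j))
      (htkT.comp hφt) (fun j => hMpos (φ j)) (hMlim.comp hφt) (fun j => hMbd (φ j))
      (fun j => hnear (φ j)) (fun s y => curl (U s) y) (fun s hs y => hUcurl s (hs.trans_lt hB) y)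
  -- Proposition 2.1 (as printed) for the limit: under Type I, `curl ū(s)(y) ≠ 0` for some `s < 0`
  have hne0 : U 0 0 ≠ 0 := by
    intro h
    rw [h, norm_zero] at hU00
    exact zero_ne_one hU00
  obtain ⟨-, s, hs, y, hy⟩ := gigaMiura2011_nearMaxLimit_curl_ne_zero_of_typeI hν hI
    (fun j => (htk (φ j)).2) (htkT.comp hφt) (fun j => hMpos (φ j)) (hMlim.comp hφt) hB hUsm
    ⟨2, hU2⟩ hUdiv hUmild hne0 (fun s hs y => hUconv s (hs.trans hB) y)
  exact hy (hzero s hs.le y)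

/-- **Giga–Miura 2011, Theorem 1.1 as printed ((CA) under Type I), PROVED inside Literature** —
discharge of the named fact `gigaMiura_continuousAlignment_typeI` (`ContinuousAlignmentTypeI`), by
Remark 1.4 ((CA) ⇒ (CA′), `gigaMiura_continuousAlignment_typeI_of_scaledAlignment`) from the (CA′)
theorem. [cite: GigaMiura2011, Thm 1.1 (§1, HUPS preprint #956 p. 3) with Remark 1.4 (p. 4)] -/
theorem gigaMiura_continuousAlignment_typeI_holds : gigaMiura_continuousAlignment_typeI :=
  gigaMiura_continuousAlignment_typeI_of_scaledAlignment gigaMiura2011_scaledAlignment_typeI_holds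

end Assembly

end Literature.Analysis.FluidPDE

end
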